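import Summits.BirchSwinnertonDyer.BirchSwinnertonDyer.Theorems.ClassRecordThreeRegCertKernel
import Summits.BirchSwinnertonDyer.BirchSwinnertonDyer.Theorems.ClassRecordThreeRegCertKernelDeep
import HarnessLib

/-!
# Route `ClassRecordThree`, crux `SchneiderAtThree` (item 19106): the REG3CERT kernel certificate checker at a DEEP
# certificate point (`v₃(e(Q)) = K ≥ 2`) — from one row's integers to `RegMult.CertNonsplit W 3 Q 1`
# (cell `bsd-stepL`, seat `bsd-stepL-reg3-eng` g3; `--supports stmt-BirchSwinnertonDyer-19106`)

HONEST FRAMING: BSD is not proved by any of this; nothing here closes the crux; Schneider's non-degeneracy conjecture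
(barrier `PAdicHeightNondegeneracy`) is asserted NOWHERE; every application is ONE curve. Companion of
`…RegCertKernel` (`v₃(e(Q)) = 1`): for a REG3CERT row (kit j249075 / j249895) whose point `Q = (a/e², b/e³)` has
`e = 3^K e'`, `K ≥ 2`, the checker `certNonsplit_of_deepCert` takes ONE bundled integer hypothesis — `c₄, c₆` in terms of
the `aᵢ`, `3 ∤ c₆`, `γ ≡ −c₄/c₆ (mod 9)` (only to certify `‖C²‖ = 1`), `2 ≤ K`, `3 ∤ e'`, `3 ∤ b`, `gcd(a, e) = 1`, the gcd
reduction test, and the certificate **`9 ∤ b⁴ − a⁴`** — and returns admissibility of `Q` at `3` plus the height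
inequality for every `‖q‖₃ < 1` (`heightFourOneCoord_ne_zero_of_deepCert`). The rung modulo GZK then follows from
`rung_of_cert` / `rungTam_of_cert` of `…RegCertKernel`. Theorems only (0 defs, 0 facts).
References: [SteinWuthrich2013] §4.2; [MazurSteinTate2006] §1; [SilvermanAEC2009] VII.2.1, VII.3.4.
-/

open scoped Classical

open WeierstrassCurve Literature.NumberTheory.EllipticCurves
  Literature.NumberTheory.EllipticCurves.Rank1Residual
  Literature.NumberTheory.EllipticCurves.SteinWuthrich2013
  Summit.BirchSwinnertonDyer.Rank1Residual
  Summit.BirchSwinnertonDyer.Rank1Residual.X11b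

namespace Summit.BirchSwinnertonDyer.Rank1Residual.X11b.RegMult.KernelCert

/-- **`RegMult.CertNonsplit W 3 Q 1` from a DEEP REG3CERT certificate (`v₃(e(Q)) = K ≥ 2`).** For the integer model
`W = ⟨a₁,…,a₆⟩` (globally minimal, elliptic) and a point `Q = (x, y) = (a/e², b/e³)` of `W` with `e = 3^K e'`, the
hypothesis `H` bundles the row's integer facts (`c₄`, `c₆`, `3 ∤ c₆`, `9 ∣ c₄ + γc₆`, `3 ∤ γ`, `2 ≤ K`, `3 ∤ e'`, `3 ∤ b`,
`gcd(a, e) = 1`, the gcd reduction test `gcd(Φ_y·e³, Φ_x·e⁴) ∣ eⁿ`, and **`9 ∤ b⁴ − a⁴`**), decided per row by ONE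
`norm_num`; the conclusion is admissibility of `Q = 1 • Q` at `3` (`isAdmissible_of_one_lt_norm`,
`hasNonsingularReductionAt_of_gcd`) and `heightFourOneCoord W 3 q x y ≠ 0` for every `‖q‖₃ < 1`
(`heightFourOneCoord_ne_zero_of_deepCert`: `h ≡ e'⁴(b⁴ − a⁴)/(2b⁴) (mod 9)`). Per curve; nothing class-wide.
[cite: SteinWuthrich2013, §4.2] [cite: MazurSteinTate2006, §1] [cite: SilvermanAEC2009, VII.3.4] -/
theorem certNonsplit_of_deepCert (W : WeierstrassCurve ℚ) {a₁ a₂ a₃ a₄ a₆ : ℤ} (hW : W = ⟨a₁, a₂, a₃, a₄, a₆⟩)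
    [W.IsElliptic] [W.IsGloballyMinimal] {a b c4 c6 γ : ℤ} {e' K n : ℕ}
    (H : c4 = (a₁ ^ 2 + 4 * a₂) ^ 2 - 24 * (2 * a₄ + a₁ * a₃) ∧
      c6 = -(a₁ ^ 2 + 4 * a₂) ^ 3 + 36 * (a₁ ^ 2 + 4 * a₂) * (2 * a₄ + a₁ * a₃) - 216 * (a₃ ^ 2 + 4 * a₆) ∧
      ¬ (3 : ℤ) ∣ c6 ∧ (9 : ℤ) ∣ c4 + γ * c6 ∧ ¬ (3 : ℤ) ∣ γ ∧ 2 ≤ K ∧ ¬ (3 : ℤ) ∣ e' ∧ ¬ (3 : ℤ) ∣ b ∧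
      Nat.Coprime a.natAbs (3 ^ K * e') ∧
      Int.gcd (2 * b + a₁ * a * (3 ^ K * e' : ℕ) + a₃ * (3 ^ K * e' : ℕ) ^ 3)
        (a₁ * b * (3 ^ K * e' : ℕ) - (3 * a ^ 2 + 2 * a₂ * a * (3 ^ K * e' : ℕ) ^ 2 + a₄ * (3 ^ K * e' : ℕ) ^ 4)) ∣
        (3 ^ K * e') ^ n ∧
      ¬ (9 : ℤ) ∣ b ^ 4 - a ^ 4)
    {x y : ℚ} (hx : x = a / ((3 ^ K * e' : ℕ) : ℚ) ^ 2) (hy : y = b / ((3 ^ K * e' : ℕ) : ℚ) ^ 3)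
    (h : W.toAffine.Nonsingular x y) : RegMult.CertNonsplit W 3 (.some x y h) 1 := by
  obtain ⟨hc4, hc6, h3c6, hγ, h3γ, hK, h3e', h3b, hcop, hgcd, hcert⟩ := H
  have he'0 : e' ≠ 0 := by rintro rfl; exact h3e' (by simp)
  have he0 : (3 ^ K * e' : ℕ) ≠ 0 := by positivity
  have h3e : 3 ∣ 3 ^ K * e' := dvd_mul_of_dvd_left (dvd_pow_self 3 (by omega)) e'
  have hx1 : 1 < ‖(x : ℚ_[3])‖ := by
    haveI : Fact (Nat.Prime 3) := ⟨Nat.prime_three⟩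
    exact (one_lt_norm_ratCast_iff 3 x).mpr (padicValRat_x_neg he0 hx hcop h3e)
  have hadm : W.IsAdmissible 3 (.some x y h) :=
    isAdmissible_of_one_lt_norm (by norm_num) h hx1 (hasNonsingularReductionAt_of_gcd W hW he0 hx hy hcop hgcd)
  refine ⟨by rw [one_smul]; exact hadm, fun q _ hq1 _ => ?_⟩
  rw [one_smul]
  exact heightFourOneCoord_ne_zero_of_deepCert W (baseChange_c₄_eq W hW hc4) (baseChange_c₆_eq W hW hc6) h3c6 hγ h3γ
    hK h3e' h3b hcop hx hy hcert hq1

end Summit.BirchSwinnertonDyer.Rank1Residual.X11b.RegMult.KernelCert
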